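import Mathlib
import HarnessLib
import Summits.Ventures.LatticeQCDFlow.Exactness.SUNStoutScheduleClassFunction
import Summits.Ventures.LatticeQCDFlow.Exactness.KernelCouplingTranslation

/-!
# The residual FLOW (a finite schedule of masked `SU(N)` stout steps with constant coefficients) commutes with every translation preserving all its masks; its exact Jacobians are translation invariant

HONEST FRAMING: exact (Metropolis-corrected) sampling algorithms for lattice gauge theory;
figures of merit are autocorrelation/cost numbers at stated couplings and volumes; no
continuum-physics claim.

Venture `LatticeQCDFlow` (cell pub-lqcd), topic `Exactness`; FANOUT row 10 (`eng-equiv`, engine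
`latflow.equiv` `residual.py` / `flows_jax.residual_flow`: a stack of masked stout steps cycling
through the direction masks of `masks.py`).  NEW WORK of the cell, the translation twin of
`SUNStoutScheduleClassFunction` (flow level): the schedule as a measurable automorphism
(`exists_measurableEquiv_stoutSchedule`) combined with `KernelCouplingTranslation`
(`sunStoutLayer_siteTranslate`, `foldr_comp_siteTranslate`, `HasJacobian.jac_siteTranslate_ae_eq` /
`jac_siteTranslate_eq`).  Nothing is cited as a fact; no number; no definition.  HYPOTHESIS on the
translation `t`: it preserves EVERY mask of the schedule (`ps i e ↔ ps i (e + t)` for all steps `i`) —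
by `directionMask_siteTranslate_of_ker` / `stripesPhase_apply_eq_zero` every translation of the width
sublattice `wℤ^d` does, for the whole masking cycle at once.

* **`stoutSchedule_siteTranslate`** — the composite map of the schedule (composition convention of
  `SUNStoutScheduleClassFunction`) commutes with `Θ_t`;
* **`ae_translationInvariant_jacobian_stoutSchedule`** — EVERY measurable exact Jacobian of the
  schedule for `⊗_e Haar_{SU(n)}` (frozen-staple masks, `2(d−1)|rs i| < 1` per step) satisfies
  `J (V·t) = J V` for a.e. `V`;
* **`translationInvariant_jacobian_stoutSchedule`** — every continuous exact Jacobian `j ≥ 0` (the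
  product of the per-step Jacobians of `SUNStoutScheduleJacobian`) satisfies it everywhere.

NOT here: coefficient fields that vary with the frozen context (the single-layer file
`SUNStoutLayerTranslation` has them; the schedule here has constants `rs i`, as in
`SUNStoutScheduleClassFunction`); translations permuting the masks; any number.
-/

noncomputable section

namespace Summit.Ventures.LatticeQCDFlow.Exactness

open Literature.MathematicalPhysics.QuantumFieldTheory
open Literature.MathematicalPhysics.QuantumFieldTheory.Luscher2010
open MeasureTheory
open scoped Matrix ENNReal

variable {d L n : ℕ} [NeZero L] {ι : Type*}
  (ps : ι → Edge d L → Prop) [∀ i, DecidablePred (ps i)] (rs : ι → ℝ) (sched : List ι)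
  (t : Site d L) (hpt : ∀ i (e : Edge d L), ps i e ↔ ps i (e.1 + t, e.2))

include hpt

omit [NeZero L] in
/-- **A stout schedule commutes with every translation preserving all its masks.** -/
theorem stoutSchedule_siteTranslate (V : GaugeConfig d L (Matrix.specialUnitaryGroup (Fin n) ℂ)) :
    (sched.foldr (fun i (G : GaugeConfig d L (Matrix.specialUnitaryGroup (Fin n) ℂ) →
          GaugeConfig d L (Matrix.specialUnitaryGroup (Fin n) ℂ)) =>
        G ∘ fun (V : GaugeConfig d L (Matrix.specialUnitaryGroup (Fin n) ℂ)) (e : Edge d L) =>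
          if ps i e then
            (⟨NormedSpace.exp ((rs i : ℂ) • suProj (plaquetteLoopSum V e.1 e.2)),
                exp_smul_suProj_mem (rs i) (plaquetteLoopSum V e.1 e.2)⟩ :
              Matrix.specialUnitaryGroup (Fin n) ℂ) * V e
          else V e) id) (GaugeConfig.siteTranslate t V) =
      GaugeConfig.siteTranslate t
        ((sched.foldr (fun i (G : GaugeConfig d L (Matrix.specialUnitaryGroup (Fin n) ℂ) →
            GaugeConfig d L (Matrix.specialUnitaryGroup (Fin n) ℂ)) =>
          G ∘ fun (V : GaugeConfig d L (Matrix.specialUnitaryGroup (Fin n) ℂ)) (e : Edge d L) =>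
            if ps i e then
              (⟨NormedSpace.exp ((rs i : ℂ) • suProj (plaquetteLoopSum V e.1 e.2)),
                  exp_smul_suProj_mem (rs i) (plaquetteLoopSum V e.1 e.2)⟩ :
                Matrix.specialUnitaryGroup (Fin n) ℂ) * V e
            else V e) id) V) :=
  foldr_comp_siteTranslate t
    (fun i (V : GaugeConfig d L (Matrix.specialUnitaryGroup (Fin n) ℂ)) (e : Edge d L) =>
      if ps i e then
        (⟨NormedSpace.exp ((rs i : ℂ) • suProj (plaquetteLoopSum V e.1 e.2)),
            exp_smul_suProj_mem (rs i) (plaquetteLoopSum V e.1 e.2)⟩ :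
          Matrix.specialUnitaryGroup (Fin n) ℂ) * V e
      else V e)
    (fun i V => sunStoutLayer_siteTranslate (ps i) (ps i) t (fun _ _ => rs i) (hpt i) (fun _ _ _ => rfl) V)
    sched V

variable
  (h1 : ∀ i e, ps i e → ∀ ν, ν ≠ e.2 → ¬ps i (e.1.shift e.2, ν))
  (h2 : ∀ i e, ps i e → ∀ ν, ν ≠ e.2 → ¬ps i (e.1.shift ν, e.2))
  (h3 : ∀ i e, ps i e → ∀ ν, ν ≠ e.2 → ¬ps i (e.1, ν))
  (h4 : ∀ i e, ps i e → ∀ ν, ν ≠ e.2 → ¬ps i ((e.1 - Pi.single ν 1).shift e.2, ν))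
  (h5 : ∀ i e, ps i e → ∀ ν, ν ≠ e.2 → ¬ps i (e.1 - Pi.single ν 1, e.2))
  (h6 : ∀ i e, ps i e → ∀ ν, ν ≠ e.2 → ¬ps i (e.1 - Pi.single ν 1, ν))
  (hr : ∀ i, 2 * (d - 1 : ℝ) * |rs i| < 1)

include h1 h2 h3 h4 h5 h6 hr

/-- **Every measurable exact Jacobian of a stout schedule is invariant under translations preserving
all its masks, almost everywhere** (product Haar). -/
theorem ae_translationInvariant_jacobian_stoutSchedule
    {Φ : GaugeConfig d L (Matrix.specialUnitaryGroup (Fin n) ℂ) → GaugeConfig d L (Matrix.specialUnitaryGroup (Fin n) ℂ)}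
    (hΦ : Φ = sched.foldr (fun i (G : GaugeConfig d L (Matrix.specialUnitaryGroup (Fin n) ℂ) →
          GaugeConfig d L (Matrix.specialUnitaryGroup (Fin n) ℂ)) =>
        G ∘ fun (V : GaugeConfig d L (Matrix.specialUnitaryGroup (Fin n) ℂ)) (e : Edge d L) =>
          if ps i e then
            (⟨NormedSpace.exp ((rs i : ℂ) • suProj (plaquetteLoopSum V e.1 e.2)),
                exp_smul_suProj_mem (rs i) (plaquetteLoopSum V e.1 e.2)⟩ :
              Matrix.specialUnitaryGroup (Fin n) ℂ) * V e
          else V e) id)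
    {J : GaugeConfig d L (Matrix.specialUnitaryGroup (Fin n) ℂ) → ℝ≥0∞}
    (h : HasJacobian (Measure.pi fun _ : Edge d L => haarProbability (Matrix.specialUnitaryGroup (Fin n) ℂ)) Φ J) :
    ∀ᵐ U ∂(Measure.pi fun _ : Edge d L => haarProbability (Matrix.specialUnitaryGroup (Fin n) ℂ)),
      J (GaugeConfig.siteTranslate t U) = J U := by
  obtain ⟨Ψ, hΨ⟩ := exists_measurableEquiv_stoutSchedule (n := n) ps rs sched h1 h2 h3 h4 h5 h6 hr
  have hcomm : ∀ V : GaugeConfig d L (Matrix.specialUnitaryGroup (Fin n) ℂ),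
      Ψ (GaugeConfig.siteTranslate t V) = GaugeConfig.siteTranslate t (Ψ V) := fun V => by
    rw [hΨ]
    exact stoutSchedule_siteTranslate ps rs sched t hpt V
  rw [hΦ, ← hΨ] at h
  exact HasJacobian.jac_siteTranslate_ae_eq (haarProbability (Matrix.specialUnitaryGroup (Fin n) ℂ)) t hcomm h

/-- **… and everywhere for a continuous exact Jacobian `j ≥ 0`** (the residual flow's booked log-det,
the product of the per-step Jacobians). -/
theorem translationInvariant_jacobian_stoutSchedule
    {Φ : GaugeConfig d L (Matrix.specialUnitaryGroup (Fin n) ℂ) → GaugeConfig d L (Matrix.specialUnitaryGroup (Fin n) ℂ)}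
    (hΦ : Φ = sched.foldr (fun i (G : GaugeConfig d L (Matrix.specialUnitaryGroup (Fin n) ℂ) →
          GaugeConfig d L (Matrix.specialUnitaryGroup (Fin n) ℂ)) =>
        G ∘ fun (V : GaugeConfig d L (Matrix.specialUnitaryGroup (Fin n) ℂ)) (e : Edge d L) =>
          if ps i e then
            (⟨NormedSpace.exp ((rs i : ℂ) • suProj (plaquetteLoopSum V e.1 e.2)),
                exp_smul_suProj_mem (rs i) (plaquetteLoopSum V e.1 e.2)⟩ :
              Matrix.specialUnitaryGroup (Fin n) ℂ) * V e
          else V e) id)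
    {j : GaugeConfig d L (Matrix.specialUnitaryGroup (Fin n) ℂ) → ℝ} (hj : Continuous j) (hj0 : ∀ U, 0 ≤ j U)
    (h : HasJacobian (Measure.pi fun _ : Edge d L => haarProbability (Matrix.specialUnitaryGroup (Fin n) ℂ)) Φ
      (fun U => ENNReal.ofReal (j U)))
    (U : GaugeConfig d L (Matrix.specialUnitaryGroup (Fin n) ℂ)) : j (GaugeConfig.siteTranslate t U) = j U := by
  haveI : SecondCountableTopology (Matrix (Fin n) (Fin n) ℂ) :=
    inferInstanceAs (SecondCountableTopology (Fin n → Fin n → ℂ))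
  haveI : SecondCountableTopology (Matrix.specialUnitaryGroup (Fin n) ℂ) :=
    Topology.IsEmbedding.subtypeVal.secondCountableTopology
  obtain ⟨Ψ, hΨ⟩ := exists_measurableEquiv_stoutSchedule (n := n) ps rs sched h1 h2 h3 h4 h5 h6 hr
  have hcomm : ∀ V : GaugeConfig d L (Matrix.specialUnitaryGroup (Fin n) ℂ),
      Ψ (GaugeConfig.siteTranslate t V) = GaugeConfig.siteTranslate t (Ψ V) := fun V => by
    rw [hΨ]
    exact stoutSchedule_siteTranslate ps rs sched t hpt V
  rw [hΦ, ← hΨ] at h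
  exact HasJacobian.jac_siteTranslate_eq t hcomm hj hj0 h U

end Summit.Ventures.LatticeQCDFlow.Exactness

end
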